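import Summits.KontsevichZagierPeriods.KontsevichZagierPeriods.Theorems.HurwitzMicroSectorsHurwitzSectorComplementStubLadderDescentAlgebra
import Literature.NumberTheory.Transcendental.EllIterRep

/-!
# `HurwitzSectorComplement` (stmt-KontsevichZagierPeriods-14341), line `chebyshev-level-deformation`,
# stub S3 `stub_ladderDescent` — part 2: the chain cells and the instantiated ladder engine

The ladder objects live over `(0,1)^m × Δ_k(v₀)`, `Δ_k(v₀) = {0 < y₀ < y₁ < ⋯ < y_{k−1} < v₀}` the
INCREASING chain below the cyclotomic half-angle `v₀ = tan(πj/L)` (`0 < j`, `2j < L`), with weight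
`∏ 2/(1+y_i²)` and kernel parameter the smallest coordinate `y₀`. This def-free file

* proves that `Δ_k(v₀)` is `ℚ`-semialgebraic and bounded and carries the representation
  `[Δ_k(v₀), ∏ 2/(1+y_i²)]` (`exists_chainRep`), and that `[(0,1)^{m+2}, 1/(1−x₀⋯x_{m+1})]` exists
  (`exists_boxInvRep`);
* instantiates the engine S1 (`stub_ladderEngine`, taken as the section hypotheses `hT`, `hU`) on
  these cells: the T-step / U-step from `(0,1)^{m+2} × Δ_{k+1}` to `(0,1)^{m+1} × Δ_{k+2}`
  (`ladder_T`, `ladder_U`; the new parameter is prepended to the chain, `chain_succ_iff`) and from the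
  plain box `(0,1)^{m+2}` (`k = 0`, `D = univ`, `W = 1`, `lam = v₀`) to `(0,1)^{m+1} × Δ₁`
  (`ladder_T0`, `ladder_U0`);
* rewrites the bottom cell S2b (`stub_bottomCell`, a hypothesis) in ladder shape (`base_of_bottomCell`).

References: M. Kontsevich, D. Zagier, *Periods* (2001), §1.2.
-/

noncomputable section

open Set MeasureTheory
open scoped BigOperators
open Literature.NumberTheory.Transcendental
open Literature.ModelTheory.ExponentialFields (IsSemialgebraic isSemialgebraic_univ)

namespace Summit.KontsevichZagierPeriods.Theorems.HurwitzMicroSectorsHurwitzSectorComplement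

namespace LadderDescent

/-! ## The chain cells `Δ_k(v)` -/

/-- `Δ_k(v) = {y | 0 < y_i < v, y increasing}` is `ℚ`-semialgebraic for algebraic `v`. [folklore] -/
theorem isSemialgebraic_chain (k : ℕ) {v : ℝ} (hv : IsAlgebraic ℚ v) :
    IsSemialgebraic ℚ {y : Fin k → ℝ | (∀ i, 0 < y i ∧ y i < v) ∧ ∀ i i' : Fin k, i < i' → y i < y i'} := by
  have h : {y : Fin k → ℝ | (∀ i, 0 < y i ∧ y i < v) ∧ ∀ i i' : Fin k, i < i' → y i < y i'} =
      (⋂ i ∈ (Finset.univ : Finset (Fin k)), ({y : Fin k → ℝ | (0:ℝ) < y i} ∩ {y | y i < v})) ∩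
        {y | StrictMono y} := by
    ext y
    simp only [mem_setOf_eq, mem_inter_iff, mem_iInter, Finset.mem_univ, forall_const, StrictMono]
  rw [h]
  exact (IsSemialgebraic.biInter _ _ fun i _ =>
    (KZ.isSemialgebraic_setOf_const_lt_apply isAlgebraic_zero i).inter
      (KZ.isSemialgebraic_setOf_apply_lt_const hv i)).inter (KZ.isSemialgebraic_setOf_strictMono k)

/-- `Δ_k(v)` is bounded (inside the closed sup-ball of radius `|v|`). [folklore] -/
theorem isBounded_chain (k : ℕ) (v : ℝ) :
    Bornology.IsBounded {y : Fin k → ℝ | (∀ i, 0 < y i ∧ y i < v) ∧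
      ∀ i i' : Fin k, i < i' → y i < y i'} :=
  (Metric.isBounded_closedBall (x := (0 : Fin k → ℝ)) (r := |v|)).subset fun y hy => by
    rw [mem_closedBall_zero_iff, pi_norm_le_iff_of_nonneg (abs_nonneg v)]
    intro i
    rw [Real.norm_eq_abs, abs_le]
    have h := hy.1 i
    exact ⟨by linarith [abs_nonneg v, h.1], h.2.le.trans (le_abs_self v)⟩

/-- **The chain representation** `[Δ_k(v), ∏ 2/(1+y_i²)]` exists for algebraic `v` (bounded integrand on
a bounded `ℚ`-semialgebraic cell). [cite: KontsevichZagier2001, §1.1] -/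
theorem exists_chainRep (k : ℕ) {v : ℝ} (hv : IsAlgebraic ℚ v) : ∃ c : KZ.IntegralRep k,
    c.domain = {y | (∀ i, 0 < y i ∧ y i < v) ∧ ∀ i i' : Fin k, i < i' → y i < y i'} ∧
    c.integrand = fun y => ∏ i, 2 / (1 + (y i) ^ 2) := by
  have hD := isSemialgebraic_chain k hv
  have hW := isSemialgebraicFunOn_prodOmega hD
  have hmeas : MeasurableSet {y : Fin k → ℝ | (∀ i, 0 < y i ∧ y i < v) ∧
      ∀ i i' : Fin k, i < i' → y i < y i'} := IsSemialgebraic.measurableSet_holds hD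
  refine ⟨⟨_, _, hD, hW, ?_⟩, rfl, rfl⟩
  refine Integrable.mono' (g := fun _ => (2 : ℝ) ^ k)
    (integrableOn_const ((isBounded_chain k v).measure_lt_top.ne))
    (KZ.aestronglyMeasurable_of_isSemialgebraicFunOn hW hmeas)
    (Filter.Eventually.of_forall fun y => ?_)
  rw [Real.norm_eq_abs]
  exact abs_prod_omega_le y

/-- **The box representation** `[(0,1)^{m+2}, 1/(1 − x₀⋯x_{m+1})]` exists (integrable for `m + 2 ≥ 2`,
`BoxIntegral.integrableOn_box_one_div_one_sub_prod`). [cite: KontsevichZagier2001, §1.1] -/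
theorem exists_boxInvRep (m : ℕ) : ∃ b : KZ.IntegralRep (m + 2),
    b.domain = {x | ∀ i, x i ∈ Set.Ioo (0:ℝ) 1} ∧ b.integrand = fun x => 1 / (1 - ∏ i, x i) := by
  have hB := SymReduction.isSemialgebraic_unitBox (m + 2)
  refine ⟨⟨_, _, hB, ?_, BoxIntegral.integrableOn_box_one_div_one_sub_prod (by omega)⟩, rfl, rfl⟩
  have h1 : IsSemialgebraicFunOn ℚ {x : Fin (m + 2) → ℝ | ∀ i, x i ∈ Set.Ioo (0:ℝ) 1} fun _ => (1 : ℝ) :=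
    (isSemialgebraicFunOn_const_ratCast hB 1).congr fun _ _ => by push_cast; rfl
  exact h1.div (h1.fun_sub
      (IsSemialgebraicFunOn.fun_finsetProd Finset.univ hB fun i _ => isSemialgebraicFunOn_apply hB i))
    fun x hx => (sub_pos.2 (BoxIntegral.prod_mem_Ioo (by omega) hx).2).ne'

/-- Prepending the new smallest parameter: `(tail y ∈ Δ_{k+1}(v) ∧ 0 < y₀ < y₁) ↔ y ∈ Δ_{k+2}(v)`.
[folklore] -/
theorem chain_succ_iff {k : ℕ} (v : ℝ) (y : Fin (k + 1 + 1) → ℝ) :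
    (((∀ i : Fin (k + 1), 0 < y i.succ ∧ y i.succ < v) ∧
        ∀ i i' : Fin (k + 1), i < i' → y i.succ < y i'.succ) ∧
      0 < y 0 ∧ y 0 < y (0 : Fin (k + 1)).succ) ↔
    ((∀ i, 0 < y i ∧ y i < v) ∧ ∀ i i' : Fin (k + 1 + 1), i < i' → y i < y i') := by
  constructor
  · rintro ⟨⟨hb, hm⟩, h0, h01⟩
    have hsm : StrictMono y := by
      rw [Fin.strictMono_iff_lt_succ]
      intro i
      refine Fin.cases ?_ (fun j => ?_) i
      · simpa using h01
      · rw [← Fin.succ_castSucc]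
        exact hm _ _ Fin.castSucc_lt_succ
    exact ⟨fun i => Fin.cases ⟨h0, h01.trans (hb 0).2⟩ (fun j => hb j) i, fun i i' h => hsm h⟩
  · rintro ⟨hb, hm⟩
    exact ⟨⟨fun i => hb i.succ, fun i i' h => hm _ _ (Fin.succ_lt_succ_iff.mpr h)⟩, (hb 0).1,
      hm _ _ (Fin.succ_pos 0)⟩

/-- The first parameter: `(0 < y₀ < v) ↔ y ∈ Δ₁(v)` (the chain condition on `Fin 1` is vacuous).
[folklore] -/
theorem chain_one_iff (v : ℝ) (y : Fin (0 + 1) → ℝ) :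
    ((fun j : Fin 0 => y j.succ) ∈ (Set.univ : Set (Fin 0 → ℝ)) ∧ 0 < y 0 ∧ y 0 < v) ↔
    ((∀ i, 0 < y i ∧ y i < v) ∧ ∀ i i' : Fin (0 + 1), i < i' → y i < y i') := by
  constructor
  · rintro ⟨-, h0, hv⟩
    refine ⟨fun i => ?_, fun i i' h => absurd (Fin.lt_def.mp h) ?_⟩
    · have hi : i = 0 := Fin.ext (by have := i.2; omega)
      subst hi
      exact ⟨h0, hv⟩
    · have := i.2
      have := i'.2
      omega
  · rintro ⟨hb, -⟩
    exact ⟨Set.mem_univ _, (hb 0).1, (hb 0).2⟩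

/-! ## The ladder engine on the chain cells -/

section Engine

variable (hT :
    (∀ (m k : ℕ) (D : Set (Fin k → ℝ)) (W lam : (Fin k → ℝ) → ℝ) (M Λ : ℝ),
      Literature.ModelTheory.ExponentialFields.IsSemialgebraic ℚ D → Bornology.IsBounded D →
      IsSemialgebraicFunOn ℚ D W → IsSemialgebraicFunOn ℚ D lam →
      (∀ y ∈ D, |W y| ≤ M) → (∀ y ∈ D, 0 < lam y ∧ lam y ≤ Λ) →
      ∀ (r : KZ.IntegralRep (m + 2 + k)),
        r.domain = {z | (∀ i : Fin (m + 2), z (Fin.castAdd k i) ∈ Set.Ioo (0:ℝ) 1) ∧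
          (fun j : Fin k => z (Fin.natAdd (m + 2) j)) ∈ D} →
        Set.EqOn r.integrand (fun z => W (fun j : Fin k => z (Fin.natAdd (m + 2) j)) *
          (((1 - ∏ i : Fin (m + 2), z (Fin.castAdd k i)) -
              (lam (fun j : Fin k => z (Fin.natAdd (m + 2) j))) ^ 2 *
                (1 + ∏ i : Fin (m + 2), z (Fin.castAdd k i))) /
            ((1 - ∏ i : Fin (m + 2), z (Fin.castAdd k i)) ^ 2 +
              (lam (fun j : Fin k => z (Fin.natAdd (m + 2) j))) ^ 2 *
                (1 + ∏ i : Fin (m + 2), z (Fin.castAdd k i)) ^ 2))) r.domain →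
        ∃ (r₁ : KZ.IntegralRep (m + 2 + k)) (r₂ : KZ.IntegralRep (m + 1 + (k + 1))),
          r₁.domain = r.domain ∧
          (r₁.integrand = fun z => W (fun j : Fin k => z (Fin.natAdd (m + 2) j)) /
            (1 - ∏ i : Fin (m + 2), z (Fin.castAdd k i))) ∧
          r₂.domain = {z | (∀ i : Fin (m + 1), z (Fin.castAdd (k + 1) i) ∈ Set.Ioo (0:ℝ) 1) ∧
            (fun j : Fin k => z (Fin.natAdd (m + 1) j.succ)) ∈ D ∧
            0 < z (Fin.natAdd (m + 1) 0) ∧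
            z (Fin.natAdd (m + 1) 0) < lam ((fun j : Fin k => z (Fin.natAdd (m + 1) j.succ)))} ∧
          (r₂.integrand = fun z => W ((fun j : Fin k => z (Fin.natAdd (m + 1) j.succ))) *
            (2 / (1 + (z (Fin.natAdd (m + 1) 0)) ^ 2)) *
            (2 * z (Fin.natAdd (m + 1) 0) /
              ((1 - ∏ i : Fin (m + 1), z (Fin.castAdd (k + 1) i)) ^ 2 +
                (z (Fin.natAdd (m + 1) 0)) ^ 2 * (1 + ∏ i : Fin (m + 1), z (Fin.castAdd (k + 1) i)) ^ 2))) ∧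
          KZ.of r - KZ.of r₁ + KZ.of r₂ ∈ KZ.relations))

variable (hU :
    (∀ (m k : ℕ) (D : Set (Fin k → ℝ)) (W lam : (Fin k → ℝ) → ℝ) (M Λ : ℝ),
      Literature.ModelTheory.ExponentialFields.IsSemialgebraic ℚ D → Bornology.IsBounded D →
      IsSemialgebraicFunOn ℚ D W → IsSemialgebraicFunOn ℚ D lam →
      (∀ y ∈ D, |W y| ≤ M) → (∀ y ∈ D, 0 < lam y ∧ lam y ≤ Λ) →
      ∀ (r : KZ.IntegralRep (m + 2 + k)),
        r.domain = {z | (∀ i : Fin (m + 2), z (Fin.castAdd k i) ∈ Set.Ioo (0:ℝ) 1) ∧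
          (fun j : Fin k => z (Fin.natAdd (m + 2) j)) ∈ D} →
        Set.EqOn r.integrand (fun z => W (fun j : Fin k => z (Fin.natAdd (m + 2) j)) *
          (2 * lam (fun j : Fin k => z (Fin.natAdd (m + 2) j)) /
            ((1 - ∏ i : Fin (m + 2), z (Fin.castAdd k i)) ^ 2 +
              (lam (fun j : Fin k => z (Fin.natAdd (m + 2) j))) ^ 2 *
                (1 + ∏ i : Fin (m + 2), z (Fin.castAdd k i)) ^ 2))) r.domain →
        ∃ (r₂ : KZ.IntegralRep (m + 1 + (k + 1))),
          r₂.domain = {z | (∀ i : Fin (m + 1), z (Fin.castAdd (k + 1) i) ∈ Set.Ioo (0:ℝ) 1) ∧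
            (fun j : Fin k => z (Fin.natAdd (m + 1) j.succ)) ∈ D ∧
            0 < z (Fin.natAdd (m + 1) 0) ∧
            z (Fin.natAdd (m + 1) 0) < lam ((fun j : Fin k => z (Fin.natAdd (m + 1) j.succ)))} ∧
          (r₂.integrand = fun z => W ((fun j : Fin k => z (Fin.natAdd (m + 1) j.succ))) *
            (2 / (1 + (z (Fin.natAdd (m + 1) 0)) ^ 2)) *
            (((1 - ∏ i : Fin (m + 1), z (Fin.castAdd (k + 1) i)) -
                (z (Fin.natAdd (m + 1) 0)) ^ 2 * (1 + ∏ i : Fin (m + 1), z (Fin.castAdd (k + 1) i))) /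
              ((1 - ∏ i : Fin (m + 1), z (Fin.castAdd (k + 1) i)) ^ 2 +
                (z (Fin.natAdd (m + 1) 0)) ^ 2 * (1 + ∏ i : Fin (m + 1), z (Fin.castAdd (k + 1) i)) ^ 2))) ∧
          KZ.of r - KZ.of r₂ ∈ KZ.relations))

include hT in
/-- **The T-step on the chain cells**: from `(0,1)^{m+2} × Δ_{k+1}(v₀)` to
`(0,1)^{m+1} × Δ_{k+2}(v₀)`, `v₀ = tan(πj/L)`; the engine S1 instantiated with `D = Δ_{k+1}(v₀)`,
`W = ∏ 2/(1+y_i²)` (`|W| ≤ 2^{k+1}`), `lam y = y₀ ≤ v₀`. [cite: KontsevichZagier2001, §1.2] -/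
theorem ladder_T (m k j L : ℕ) (hj : 0 < j) (hjL : 2 * j < L)
    (r : KZ.IntegralRep (m + 2 + (k + 1)))
    (hdom : r.domain = {z | (∀ i : Fin (m + 2), z (Fin.castAdd (k + 1) i) ∈ Set.Ioo (0:ℝ) 1) ∧
        (∀ i : Fin (k + 1), 0 < z (Fin.natAdd (m + 2) i) ∧ z (Fin.natAdd (m + 2) i) < Real.tan (Real.pi * j / L)) ∧
        (∀ i i' : Fin (k + 1), i < i' → z (Fin.natAdd (m + 2) i) < z (Fin.natAdd (m + 2) i'))})
    (hint : Set.EqOn r.integrand (fun z => (∏ i : Fin (k + 1), 2 / (1 + (z (Fin.natAdd (m + 2) i)) ^ 2)) *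
        (((1 - ∏ i : Fin (m + 2), z (Fin.castAdd (k + 1) i)) - (z (Fin.natAdd (m + 2) 0)) ^ 2 * (1 + ∏ i : Fin (m + 2), z (Fin.castAdd (k + 1) i))) /
          ((1 - ∏ i : Fin (m + 2), z (Fin.castAdd (k + 1) i)) ^ 2 + (z (Fin.natAdd (m + 2) 0)) ^ 2 * (1 + ∏ i : Fin (m + 2), z (Fin.castAdd (k + 1) i)) ^ 2))) r.domain) :
    ∃ (r₁ : KZ.IntegralRep (m + 2 + (k + 1))) (r₂ : KZ.IntegralRep (m + 1 + (k + 1 + 1))),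
      r₁.domain = r.domain ∧
      (r₁.integrand = fun z => (∏ i : Fin (k + 1), 2 / (1 + (z (Fin.natAdd (m + 2) i)) ^ 2)) /
        (1 - ∏ i : Fin (m + 2), z (Fin.castAdd (k + 1) i))) ∧
      r₂.domain = {z | (∀ i : Fin (m + 1), z (Fin.castAdd (k + 1 + 1) i) ∈ Set.Ioo (0:ℝ) 1) ∧
        (∀ i : Fin (k + 1 + 1), 0 < z (Fin.natAdd (m + 1) i) ∧ z (Fin.natAdd (m + 1) i) < Real.tan (Real.pi * j / L)) ∧
        (∀ i i' : Fin (k + 1 + 1), i < i' → z (Fin.natAdd (m + 1) i) < z (Fin.natAdd (m + 1) i'))} ∧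
      Set.EqOn r₂.integrand (fun z => (∏ i : Fin (k + 1 + 1), 2 / (1 + (z (Fin.natAdd (m + 1) i)) ^ 2)) *
        (2 * z (Fin.natAdd (m + 1) 0) /
          ((1 - ∏ i : Fin (m + 1), z (Fin.castAdd (k + 1 + 1) i)) ^ 2 + (z (Fin.natAdd (m + 1) 0)) ^ 2 * (1 + ∏ i : Fin (m + 1), z (Fin.castAdd (k + 1 + 1) i)) ^ 2))) r₂.domain ∧
      KZ.of r - KZ.of r₁ + KZ.of r₂ ∈ KZ.relations := by
  obtain ⟨hv, halg⟩ := tan_pos_and_isAlgebraic hj hjL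
  set v := Real.tan (Real.pi * j / L) with hv_def
  have hD := isSemialgebraic_chain (k + 1) halg
  obtain ⟨r₁, r₂, h1d, h1i, h2d, h2i, hrel⟩ := hT m (k + 1)
    {y | (∀ i, 0 < y i ∧ y i < v) ∧ ∀ i i' : Fin (k + 1), i < i' → y i < y i'}
    (fun y => ∏ i, 2 / (1 + (y i) ^ 2)) (fun y => y 0) (2 ^ (k + 1)) v hD (isBounded_chain (k + 1) v)
    (isSemialgebraicFunOn_prodOmega hD) (isSemialgebraicFunOn_apply hD 0)
    (fun y _ => abs_prod_omega_le y) (fun y hy => ⟨(hy.1 0).1, (hy.1 0).2.le⟩) r hdom hint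
  refine ⟨r₁, r₂, h1d, h1i, ?_, ?_, hrel⟩
  · rw [h2d]
    ext z
    simp only [mem_setOf_eq]
    exact and_congr_right fun _ => chain_succ_iff v (fun i => z (Fin.natAdd (m + 1) i))
  · intro z _
    rw [h2i]
    simp only [Fin.prod_univ_succ]
    ring

include hU in
/-- **The U-step on the chain cells**: from `(0,1)^{m+2} × Δ_{k+1}(v₀)` to
`(0,1)^{m+1} × Δ_{k+2}(v₀)`, `v₀ = tan(πj/L)`; the engine S1 instantiated with `D = Δ_{k+1}(v₀)`,
`W = ∏ 2/(1+y_i²)` (`|W| ≤ 2^{k+1}`), `lam y = y₀ ≤ v₀`. [cite: KontsevichZagier2001, §1.2] -/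
theorem ladder_U (m k j L : ℕ) (hj : 0 < j) (hjL : 2 * j < L)
    (r : KZ.IntegralRep (m + 2 + (k + 1)))
    (hdom : r.domain = {z | (∀ i : Fin (m + 2), z (Fin.castAdd (k + 1) i) ∈ Set.Ioo (0:ℝ) 1) ∧
        (∀ i : Fin (k + 1), 0 < z (Fin.natAdd (m + 2) i) ∧ z (Fin.natAdd (m + 2) i) < Real.tan (Real.pi * j / L)) ∧
        (∀ i i' : Fin (k + 1), i < i' → z (Fin.natAdd (m + 2) i) < z (Fin.natAdd (m + 2) i'))})
    (hint : Set.EqOn r.integrand (fun z => (∏ i : Fin (k + 1), 2 / (1 + (z (Fin.natAdd (m + 2) i)) ^ 2)) *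
        (2 * z (Fin.natAdd (m + 2) 0) /
          ((1 - ∏ i : Fin (m + 2), z (Fin.castAdd (k + 1) i)) ^ 2 + (z (Fin.natAdd (m + 2) 0)) ^ 2 * (1 + ∏ i : Fin (m + 2), z (Fin.castAdd (k + 1) i)) ^ 2))) r.domain) :
    ∃ (r₂ : KZ.IntegralRep (m + 1 + (k + 1 + 1))),
      r₂.domain = {z | (∀ i : Fin (m + 1), z (Fin.castAdd (k + 1 + 1) i) ∈ Set.Ioo (0:ℝ) 1) ∧
        (∀ i : Fin (k + 1 + 1), 0 < z (Fin.natAdd (m + 1) i) ∧ z (Fin.natAdd (m + 1) i) < Real.tan (Real.pi * j / L)) ∧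
        (∀ i i' : Fin (k + 1 + 1), i < i' → z (Fin.natAdd (m + 1) i) < z (Fin.natAdd (m + 1) i'))} ∧
      Set.EqOn r₂.integrand (fun z => (∏ i : Fin (k + 1 + 1), 2 / (1 + (z (Fin.natAdd (m + 1) i)) ^ 2)) *
        (((1 - ∏ i : Fin (m + 1), z (Fin.castAdd (k + 1 + 1) i)) - (z (Fin.natAdd (m + 1) 0)) ^ 2 * (1 + ∏ i : Fin (m + 1), z (Fin.castAdd (k + 1 + 1) i))) /
          ((1 - ∏ i : Fin (m + 1), z (Fin.castAdd (k + 1 + 1) i)) ^ 2 + (z (Fin.natAdd (m + 1) 0)) ^ 2 * (1 + ∏ i : Fin (m + 1), z (Fin.castAdd (k + 1 + 1) i)) ^ 2))) r₂.domain ∧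
      KZ.of r - KZ.of r₂ ∈ KZ.relations := by
  obtain ⟨hv, halg⟩ := tan_pos_and_isAlgebraic hj hjL
  set v := Real.tan (Real.pi * j / L) with hv_def
  have hD := isSemialgebraic_chain (k + 1) halg
  obtain ⟨r₂, h2d, h2i, hrel⟩ := hU m (k + 1)
    {y | (∀ i, 0 < y i ∧ y i < v) ∧ ∀ i i' : Fin (k + 1), i < i' → y i < y i'}
    (fun y => ∏ i, 2 / (1 + (y i) ^ 2)) (fun y => y 0) (2 ^ (k + 1)) v hD (isBounded_chain (k + 1) v)
    (isSemialgebraicFunOn_prodOmega hD) (isSemialgebraicFunOn_apply hD 0)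
    (fun y _ => abs_prod_omega_le y) (fun y hy => ⟨(hy.1 0).1, (hy.1 0).2.le⟩) r hdom hint
  refine ⟨r₂, ?_, ?_, hrel⟩
  · rw [h2d]
    ext z
    simp only [mem_setOf_eq]
    exact and_congr_right fun _ => chain_succ_iff v (fun i => z (Fin.natAdd (m + 1) i))
  · intro z _
    rw [h2i]
    simp only [Fin.prod_univ_succ]
    ring

include hT in
/-- **The first T-step**: from the plain box `(0,1)^{m+2}` (kernel parameter `v₀ = tan(πj/L)`)
to `(0,1)^{m+1} × Δ₁(v₀)`; the engine S1 at `k = 0`, `D = univ`, `W = 1`, `lam = v₀`.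
[cite: KontsevichZagier2001, §1.2] -/
theorem ladder_T0 (m j L : ℕ) (hj : 0 < j) (hjL : 2 * j < L) (r : KZ.IntegralRep (m + 2))
    (hdom : r.domain = {x | ∀ i, x i ∈ Set.Ioo (0:ℝ) 1})
    (hint : Set.EqOn r.integrand (fun x =>
        (((1 - ∏ i, x i) - (Real.tan (Real.pi * j / L)) ^ 2 * (1 + ∏ i, x i)) /
          ((1 - ∏ i, x i) ^ 2 + (Real.tan (Real.pi * j / L)) ^ 2 * (1 + ∏ i, x i) ^ 2))) r.domain) :
    ∃ (r₁ : KZ.IntegralRep (m + 2)) (r₂ : KZ.IntegralRep (m + 1 + (0 + 1))),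
      r₁.domain = {x | ∀ i, x i ∈ Set.Ioo (0:ℝ) 1} ∧
      (r₁.integrand = fun x => 1 / (1 - ∏ i, x i)) ∧
      r₂.domain = {z | (∀ i : Fin (m + 1), z (Fin.castAdd (0 + 1) i) ∈ Set.Ioo (0:ℝ) 1) ∧
        (∀ i : Fin (0 + 1), 0 < z (Fin.natAdd (m + 1) i) ∧ z (Fin.natAdd (m + 1) i) < Real.tan (Real.pi * j / L)) ∧
        (∀ i i' : Fin (0 + 1), i < i' → z (Fin.natAdd (m + 1) i) < z (Fin.natAdd (m + 1) i'))} ∧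
      Set.EqOn r₂.integrand (fun z => (∏ i : Fin (0 + 1), 2 / (1 + (z (Fin.natAdd (m + 1) i)) ^ 2)) *
        (2 * z (Fin.natAdd (m + 1) 0) /
          ((1 - ∏ i : Fin (m + 1), z (Fin.castAdd (0 + 1) i)) ^ 2 + (z (Fin.natAdd (m + 1) 0)) ^ 2 * (1 + ∏ i : Fin (m + 1), z (Fin.castAdd (0 + 1) i)) ^ 2))) r₂.domain ∧
      KZ.of r - KZ.of r₁ + KZ.of r₂ ∈ KZ.relations := by
  obtain ⟨hv, halg⟩ := tan_pos_and_isAlgebraic hj hjL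
  set v := Real.tan (Real.pi * j / L) with hv_def
  have hdom' : r.domain = {z : Fin (m + 2) → ℝ | (∀ i : Fin (m + 2), z (Fin.castAdd 0 i) ∈ Set.Ioo (0:ℝ) 1) ∧
      (fun j : Fin 0 => z (Fin.natAdd (m + 2) j)) ∈ (Set.univ : Set (Fin 0 → ℝ))} :=
    hdom.trans (Set.ext fun z => ⟨fun h => ⟨h, Set.mem_univ _⟩, fun h => h.1⟩)
  have hint' : Set.EqOn r.integrand (fun x => (1 : ℝ) *
        (((1 - ∏ i, x i) - (v) ^ 2 * (1 + ∏ i, x i)) /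
          ((1 - ∏ i, x i) ^ 2 + (v) ^ 2 * (1 + ∏ i, x i) ^ 2))) r.domain :=
    fun x hx => by rw [hint hx]; simp only [one_mul]
  obtain ⟨r₁, r₂, h1d, h1i, h2d, h2i, hrel⟩ := hT m 0 (Set.univ : Set (Fin 0 → ℝ))
    (fun _ => 1) (fun _ => v) 1 v isSemialgebraic_univ Set.finite_univ.isBounded
    ((isSemialgebraicFunOn_const_ratCast isSemialgebraic_univ 1).congr fun _ _ => by simp)
    (isSemialgebraicFunOn_const_of_isAlgebraic isSemialgebraic_univ halg)
    (fun _ _ => by simp) (fun _ _ => ⟨hv, le_rfl⟩) r hdom' hint'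
  refine ⟨r₁, r₂, h1d.trans hdom, h1i.trans rfl, ?_, ?_, hrel⟩
  · rw [h2d]
    ext z
    simp only [mem_setOf_eq]
    exact and_congr_right fun _ => chain_one_iff v (fun i => z (Fin.natAdd (m + 1) i))
  · intro z _
    rw [h2i]
    simp only [Fin.prod_univ_succ, Fin.prod_univ_zero]
    ring

include hU in
/-- **The first U-step**: from the plain box `(0,1)^{m+2}` (kernel parameter `v₀ = tan(πj/L)`)
to `(0,1)^{m+1} × Δ₁(v₀)`; the engine S1 at `k = 0`, `D = univ`, `W = 1`, `lam = v₀`.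
[cite: KontsevichZagier2001, §1.2] -/
theorem ladder_U0 (m j L : ℕ) (hj : 0 < j) (hjL : 2 * j < L) (r : KZ.IntegralRep (m + 2))
    (hdom : r.domain = {x | ∀ i, x i ∈ Set.Ioo (0:ℝ) 1})
    (hint : Set.EqOn r.integrand (fun x =>
        (2 * Real.tan (Real.pi * j / L) /
          ((1 - ∏ i, x i) ^ 2 + (Real.tan (Real.pi * j / L)) ^ 2 * (1 + ∏ i, x i) ^ 2))) r.domain) :
    ∃ (r₂ : KZ.IntegralRep (m + 1 + (0 + 1))),
      r₂.domain = {z | (∀ i : Fin (m + 1), z (Fin.castAdd (0 + 1) i) ∈ Set.Ioo (0:ℝ) 1) ∧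
        (∀ i : Fin (0 + 1), 0 < z (Fin.natAdd (m + 1) i) ∧ z (Fin.natAdd (m + 1) i) < Real.tan (Real.pi * j / L)) ∧
        (∀ i i' : Fin (0 + 1), i < i' → z (Fin.natAdd (m + 1) i) < z (Fin.natAdd (m + 1) i'))} ∧
      Set.EqOn r₂.integrand (fun z => (∏ i : Fin (0 + 1), 2 / (1 + (z (Fin.natAdd (m + 1) i)) ^ 2)) *
        (((1 - ∏ i : Fin (m + 1), z (Fin.castAdd (0 + 1) i)) - (z (Fin.natAdd (m + 1) 0)) ^ 2 * (1 + ∏ i : Fin (m + 1), z (Fin.castAdd (0 + 1) i))) /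
          ((1 - ∏ i : Fin (m + 1), z (Fin.castAdd (0 + 1) i)) ^ 2 + (z (Fin.natAdd (m + 1) 0)) ^ 2 * (1 + ∏ i : Fin (m + 1), z (Fin.castAdd (0 + 1) i)) ^ 2))) r₂.domain ∧
      KZ.of r - KZ.of r₂ ∈ KZ.relations := by
  obtain ⟨hv, halg⟩ := tan_pos_and_isAlgebraic hj hjL
  set v := Real.tan (Real.pi * j / L) with hv_def
  have hdom' : r.domain = {z : Fin (m + 2) → ℝ | (∀ i : Fin (m + 2), z (Fin.castAdd 0 i) ∈ Set.Ioo (0:ℝ) 1) ∧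
      (fun j : Fin 0 => z (Fin.natAdd (m + 2) j)) ∈ (Set.univ : Set (Fin 0 → ℝ))} :=
    hdom.trans (Set.ext fun z => ⟨fun h => ⟨h, Set.mem_univ _⟩, fun h => h.1⟩)
  have hint' : Set.EqOn r.integrand (fun x => (1 : ℝ) *
        (2 * v /
          ((1 - ∏ i, x i) ^ 2 + (v) ^ 2 * (1 + ∏ i, x i) ^ 2))) r.domain :=
    fun x hx => by rw [hint hx]; simp only [one_mul]
  obtain ⟨r₂, h2d, h2i, hrel⟩ := hU m 0 (Set.univ : Set (Fin 0 → ℝ))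
    (fun _ => 1) (fun _ => v) 1 v isSemialgebraic_univ Set.finite_univ.isBounded
    ((isSemialgebraicFunOn_const_ratCast isSemialgebraic_univ 1).congr fun _ _ => by simp)
    (isSemialgebraicFunOn_const_of_isAlgebraic isSemialgebraic_univ halg)
    (fun _ _ => by simp) (fun _ _ => ⟨hv, le_rfl⟩) r hdom' hint'
  refine ⟨r₂, ?_, ?_, hrel⟩
  · rw [h2d]
    ext z
    simp only [mem_setOf_eq]
    exact and_congr_right fun _ => chain_one_iff v (fun i => z (Fin.natAdd (m + 1) i))
  · intro z _
    rw [h2i]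
    simp only [Fin.prod_univ_succ, Fin.prod_univ_zero]
    ring

end Engine

/-! ## The bottom cell in ladder shape -/

/-- **The bottom cell `m = 1` in ladder shape**: S2b (`stub_bottomCell`, a hypothesis) for the
U-objects `[(0,1) × Δ_{k+1}(tan(πj/L)), (∏ 2/(1+y_i²)) U(y₀, x)]` written with `∏_{i<1} x_i`.
[cite: KontsevichZagier2001, §1.2] -/
theorem base_of_bottomCell
    (hBot : (∀ (k j L : ℕ), 0 < j → 2 * j < L → ∀ (r : KZ.IntegralRep (1 + (k + 1))),
      r.domain = {z | z (Fin.castAdd (k + 1) 0) ∈ Set.Ioo (0:ℝ) 1 ∧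
        (∀ i : Fin (k + 1), 0 < z (Fin.natAdd 1 i) ∧ z (Fin.natAdd 1 i) < Real.tan (Real.pi * j / L)) ∧
        (∀ i i' : Fin (k + 1), i < i' → z (Fin.natAdd 1 i) < z (Fin.natAdd 1 i'))} →
      Set.EqOn r.integrand (fun z => (∏ i : Fin (k + 1), 2 / (1 + (z (Fin.natAdd 1 i)) ^ 2)) *
        (2 * z (Fin.natAdd 1 0) /
          ((1 - z (Fin.castAdd (k + 1) 0)) ^ 2 +
            (z (Fin.natAdd 1 0)) ^ 2 * (1 + z (Fin.castAdd (k + 1) 0)) ^ 2))) r.domain →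
      ∃ q : ℚ, ∀ (s : KZ.IntegralRep (1 + (k + 1))), s.domain = {x | ∀ i, x i ∈ Set.Ioo (0:ℝ) 1} →
        Set.EqOn s.integrand (fun x => (q : ℝ) * ∏ i, 2 / (1 + (x i) ^ 2)) s.domain →
        KZ.Equivalent r s)) :
    ∀ (k j L : ℕ), 0 < j → 2 * j < L → ∀ (r : KZ.IntegralRep (1 + (k + 1))),
      r.domain = {z | (∀ i : Fin (1), z (Fin.castAdd (k + 1) i) ∈ Set.Ioo (0:ℝ) 1) ∧
        (∀ i : Fin (k + 1), 0 < z (Fin.natAdd (1) i) ∧ z (Fin.natAdd (1) i) < Real.tan (Real.pi * j / L)) ∧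
        (∀ i i' : Fin (k + 1), i < i' → z (Fin.natAdd (1) i) < z (Fin.natAdd (1) i'))} →
      Set.EqOn r.integrand (fun z => (∏ i : Fin (k + 1), 2 / (1 + (z (Fin.natAdd (1) i)) ^ 2)) *
        (2 * z (Fin.natAdd (1) 0) /
          ((1 - ∏ i : Fin (1), z (Fin.castAdd (k + 1) i)) ^ 2 + (z (Fin.natAdd (1) 0)) ^ 2 * (1 + ∏ i : Fin (1), z (Fin.castAdd (k + 1) i)) ^ 2))) r.domain →
      ∃ q : ℚ, ∀ (s : KZ.IntegralRep (1 + (k + 1))), s.domain = {x | ∀ i, x i ∈ Set.Ioo (0:ℝ) 1} →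
        Set.EqOn s.integrand (fun x => (q : ℝ) * ∏ i, 2 / (1 + (x i) ^ 2)) s.domain →
        KZ.Equivalent r s := by
  intro k j L hj hjL r hdom hint
  refine hBot k j L hj hjL r (hdom.trans (Set.ext fun z => ?_)) fun z hz => ?_
  · simp only [mem_setOf_eq, Fin.forall_fin_one]
  · rw [hint hz]
    simp only [Fin.prod_univ_one]

end LadderDescent

/-! ## Registered sub-goal -/

/-- **Registered sub-goal `ladderDescent_chainRep`** (line `chebyshev-level-deformation`, stub S3): the
chain representation `[Δ_k(v), ∏ 2/(1+y_i²)]` over the increasing chain below an algebraic `v`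
exists. [cite: KontsevichZagier2001, §1.1] -/
theorem ladderDescent_chainRep : ∀ (k : ℕ) (v : ℝ), IsAlgebraic ℚ v → ∃ c : KZ.IntegralRep k, c.domain = {y | (∀ i, 0 < y i ∧ y i < v) ∧ ∀ i i' : Fin k, i < i' → y i < y i'} ∧ c.integrand = fun y => ∏ i, 2 / (1 + (y i) ^ 2) :=
  fun k _ hv => LadderDescent.exists_chainRep k hv

end Summit.KontsevichZagierPeriods.Theorems.HurwitzMicroSectorsHurwitzSectorComplement

end
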